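import Summits.CriticalPhenomena.PercolationContinuityZ3.Theorems.PercNearOneGluingNoHeavyLowerTailKnQuestion8CoefficientwiseCoreClassKernelMixHubPathOne
import Summits.CriticalPhenomena.PercolationContinuityZ3.Theorems.PercNearOneGluingNoHeavyLowerTailKnQuestion8CoefficientwiseCoreClassKernelMixHubProduct
import Summits.CriticalPhenomena.PercolationContinuityZ3.Theorems.PercNearOneGluingNoHeavyLowerTailKnQuestion8CoefficientwiseCoreClassKernelMixHubBundleTrace
import Mathlib.Data.Finset.Powerset
import HarnessLib

/-!
# The path lemma in set form, all four gate types at once (glue for H≼_J on all bundles, layer 3)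

Support file (`--supports stmt-CriticalPhenomena-4575`, closed), prover `prim-cplus-coupling` (gen 52).  No definitions, no notations,
no named facts, no sorries; standard axioms.  Memo `prim-cplus-coupling/A5-COUPLING-gen51.md` §2.6, §7(2); memo-50 §2.6, §2.8.

The word-form PATH LEMMA of `…KernelMixHubPathJGate` / `…HubPathJU` / `…HubPathFlip` / `…HubPathOne` (gate types `(j,j)`, `(u,j)`,
`(j,u)`, `(u,u)`, all `ℓ ≥ 1`) repackaged in the shape consumed by the product lemma `hubProduct_card_le` (…KernelMixHubProduct):
gates are Booleans (`false = u`, `true = j`; the trace of gate `g` is `[0, ri] ∪ (if g then [ℓ − rj, ℓ] else ∅)`), the class member is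
the SET `W = {ζ ⊆ [1,ℓ] : ¬ 𝒳(trace_gX ζ) ∧ 𝒴(cotrace_gY ζ)}`, complementation is the involution `ζ ↦ ζ ∆ [1,ℓ]` of `Finset ℕ`, and
`F` is any finite family closed under hub moves (not necessarily inside `[1,ℓ]`):
`hubB_path_setForm : #(F ∩ W) ≤ #(F ∩ c(W))`.  Also `hubB_path_compl_filter`: `c(W)` is the set cut out by the complementary formula.
[cite: KozmaNitzan2024, Questions 8–9 (§5.5 p. 36) (context)]
-/

namespace Summit.CriticalPhenomena.PercolationContinuityZ3.Theorems

open Finset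
open scoped symmDiff

namespace Coefficientwise

/-- Guarded intervals for Boolean gates. [folklore] -/
theorem hubB_ite_gate_false (s t : Finset ℕ) : s ∪ (if (false = true) then t else ∅) = s := by simp

/-- Guarded intervals for Boolean gates. [folklore] -/
theorem hubB_ite_gate_true (s t : Finset ℕ) : s ∪ (if (true = true) then t else ∅) = s ∪ t := by simp

/-- A word not inside `[1,ℓ]` stays outside under `· ∆ [1,ℓ]`. [folklore] -/
theorem hubB_symmDiff_not_sub (L : ℕ) (ζ : Finset ℕ) (h : ¬ ζ ⊆ Icc 1 L) : ¬ ζ ∆ Icc 1 L ⊆ Icc 1 L := by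
  intro hsub
  apply h
  intro k hk
  by_contra hk'
  have : k ∈ ζ ∆ Icc 1 L := Finset.mem_symmDiff.mpr (Or.inl ⟨hk, hk'⟩)
  exact hk' (hsub this)

open Classical in
/-- **Complementation maps the class member onto the set cut out by the complementary formula.** [folklore] -/
theorem hubB_path_compl_filter (L : ℕ) (hL : 1 ≤ L) (gX gY : Bool) (X Y : Finset ℕ → Prop)
    (D : Finset ℕ → Finset ℕ) (hD : ∀ ω, D ω = (Icc 1 (L - 1)).filter (fun k => ¬ (k ∈ ω ↔ k + 1 ∈ ω)))
    (ri ra rj rb : Finset ℕ → ℕ)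
    (hri : ∀ ω, ri ω = if 1 ∈ ω then (if h : (D ω).Nonempty then (D ω).min' h else L) else 0)
    (hra : ∀ ω, ra ω = if 1 ∈ ω then 0 else (if h : (D ω).Nonempty then (D ω).min' h else L))
    (hrj : ∀ ω, rj ω = if L ∈ ω then (if h : (D ω).Nonempty then L - (D ω).max' h else L) else 0)
    (hrb : ∀ ω, rb ω = if L ∈ ω then 0 else (if h : (D ω).Nonempty then L - (D ω).max' h else L))
    (Wp cWp : Finset ℕ → Prop)
    (hWp : ∀ ζ, Wp ζ ↔ ¬ X (Icc 0 (ri ζ) ∪ (if gX = true then Icc (L - rj ζ) L else ∅)) ∧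
      Y (Icc 0 (ra ζ) ∪ (if gY = true then Icc (L - rb ζ) L else ∅)))
    (hcWp : ∀ ζ, cWp ζ ↔ ¬ X (Icc 0 (ra ζ) ∪ (if gX = true then Icc (L - rb ζ) L else ∅)) ∧
      Y (Icc 0 (ri ζ) ∪ (if gY = true then Icc (L - rj ζ) L else ∅))) :
    ((Icc 1 L).powerset.filter (fun ζ => Wp ζ)).image (fun ζ => ζ ∆ Icc 1 L) =
      (Icc 1 L).powerset.filter (fun ζ => cWp ζ) := by
  ext ζ
  rw [hubProd_mem_image_invol (fun ζ => ζ ∆ Icc 1 L) (hubB_symmDiff_invol (Icc 1 L)), Finset.mem_filter, Finset.mem_filter,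
    Finset.mem_powerset, Finset.mem_powerset]
  by_cases hsub : ζ ⊆ Icc 1 L
  · have hc : ζ ∆ Icc 1 L = Icc 1 L \ ζ := hubB_symmDiff_eq_sdiff (Icc 1 L) ζ hsub
    have hruns := hubB_runs_compl L hL D hD ri ra rj rb hri hra hrj hrb ζ
    rw [hc, hWp, hcWp, hruns.1, hruns.2.1, hruns.2.2.1, hruns.2.2.2]
    constructor
    · rintro ⟨_, h⟩; exact ⟨hsub, h⟩
    · rintro ⟨_, h⟩; exact ⟨Finset.sdiff_subset, h⟩
  · constructor
    · rintro ⟨h, _⟩; exact absurd h (hubB_symmDiff_not_sub L ζ hsub)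
    · rintro ⟨h, _⟩; exact absurd h hsub

open Classical in
/-- **PATH LEMMA, set form, all four gate types, all `ℓ ≥ 1`** (memo-50 §2.8; memo-51 §2.6): for the hub structure of a path,
`#(F ∩ W) ≤ #(F ∩ c(W))` for every class member `W` and every family `F` of words closed under hub moves. [folklore] -/
theorem hubB_path_setForm (L : ℕ) (hL : 1 ≤ L) (gX gY : Bool) (X Y : Finset ℕ → Prop)
    (hXmono : ∀ S T : Finset ℕ, S ⊆ T → X S → X T) (hYmono : ∀ S T : Finset ℕ, S ⊆ T → Y S → Y T)
    (D : Finset ℕ → Finset ℕ) (hD : ∀ ω, D ω = (Icc 1 (L - 1)).filter (fun k => ¬ (k ∈ ω ↔ k + 1 ∈ ω)))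
    (ri ra rj rb : Finset ℕ → ℕ)
    (hri : ∀ ω, ri ω = if 1 ∈ ω then (if h : (D ω).Nonempty then (D ω).min' h else L) else 0)
    (hra : ∀ ω, ra ω = if 1 ∈ ω then 0 else (if h : (D ω).Nonempty then (D ω).min' h else L))
    (hrj : ∀ ω, rj ω = if L ∈ ω then (if h : (D ω).Nonempty then L - (D ω).max' h else L) else 0)
    (hrb : ∀ ω, rb ω = if L ∈ ω then 0 else (if h : (D ω).Nonempty then L - (D ω).max' h else L))
    (Wp : Finset ℕ → Prop)
    (hWp : ∀ ζ, Wp ζ ↔ ¬ X (Icc 0 (ri ζ) ∪ (if gX = true then Icc (L - rj ζ) L else ∅)) ∧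
      Y (Icc 0 (ra ζ) ∪ (if gY = true then Icc (L - rb ζ) L else ∅)))
    (F : Finset (Finset ℕ))
    (hFup : ∀ ζ ∈ F, ∀ a b : ℕ, a ≤ b → b ≤ L → (∀ k ∈ ζ, a < k) → (∀ k ∈ ζ, k ≤ b) → ζ ∪ Icc 1 a ∪ Icc (b + 1) L ∈ F) :
    (F ∩ (Icc 1 L).powerset.filter (fun ζ => Wp ζ)).card ≤
      (F ∩ ((Icc 1 L).powerset.filter (fun ζ => Wp ζ)).image (fun ζ => ζ ∆ Icc 1 L)).card := by
  -- the complementary formula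
  obtain ⟨cWp, hcWp⟩ : ∃ cWp : Finset ℕ → Prop, ∀ ζ, cWp ζ ↔ ¬ X (Icc 0 (ra ζ) ∪ (if gX = true then Icc (L - rb ζ) L else ∅)) ∧
      Y (Icc 0 (ri ζ) ∪ (if gY = true then Icc (L - rj ζ) L else ∅)) := ⟨_, fun _ => Iff.rfl⟩
  rw [hubB_path_compl_filter L hL gX gY X Y D hD ri ra rj rb hri hra hrj hrb Wp cWp hWp hcWp,
    Finset.inter_filter, Finset.inter_filter]
  -- the family inside [1, L]
  have hFsub' : ∀ ζ ∈ F ∩ (Icc 1 L).powerset, ζ ⊆ Icc 1 L := fun ζ hζ =>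
    Finset.mem_powerset.mp (Finset.mem_inter.mp hζ).2
  have hFup' : ∀ ζ ∈ F ∩ (Icc 1 L).powerset, ∀ a b : ℕ, a ≤ b → b ≤ L → (∀ k ∈ ζ, a < k) → (∀ k ∈ ζ, k ≤ b) →
      ζ ∪ Icc 1 a ∪ Icc (b + 1) L ∈ F ∩ (Icc 1 L).powerset := by
    intro ζ hζ a b hab hbL h1 h2
    obtain ⟨hζF, hζP⟩ := Finset.mem_inter.mp hζ
    refine Finset.mem_inter.mpr ⟨hFup ζ hζF a b hab hbL h1 h2, Finset.mem_powerset.mpr ?_⟩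
    refine Finset.union_subset (Finset.union_subset (Finset.mem_powerset.mp hζP) ?_) ?_
    · exact Finset.Icc_subset_Icc_right (le_trans hab hbL)
    · exact Finset.Icc_subset_Icc_left (by omega)
  -- case analysis on the gates
  cases gX <;> cases gY
  · -- (u,u)
    exact hubPath_uu L hL X Y hXmono hYmono D hD ri ra hri hra Wp cWp
      (fun ζ => by rw [hWp, hubB_ite_gate_false, hubB_ite_gate_false])
      (fun ζ => by rw [hcWp, hubB_ite_gate_false, hubB_ite_gate_false]) _ hFsub' hFup'
  · -- (u,j)
    by_cases hL1 : L = 1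
    · subst hL1
      exact hubPath_uj_one X Y hXmono D hD ri ra rj rb hri hra hrj hrb Wp cWp
        (fun ζ => by rw [hWp, hubB_ite_gate_false, hubB_ite_gate_true])
        (fun ζ => by rw [hcWp, hubB_ite_gate_false, hubB_ite_gate_true]) _ hFsub' hFup'
    · exact hubPath_uj L (by omega) X Y hXmono hYmono D hD ri ra rj rb hri hra hrj hrb Wp cWp
        (fun ζ => by rw [hWp, hubB_ite_gate_false, hubB_ite_gate_true])
        (fun ζ => by rw [hcWp, hubB_ite_gate_false, hubB_ite_gate_true]) _ hFsub' hFup'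
  · -- (j,u)
    by_cases hL1 : L = 1
    · subst hL1
      exact hubPath_ju_one X Y hYmono D hD ri ra rj rb hri hra hrj hrb Wp cWp
        (fun ζ => by rw [hWp, hubB_ite_gate_true, hubB_ite_gate_false])
        (fun ζ => by rw [hcWp, hubB_ite_gate_true, hubB_ite_gate_false]) _ hFsub' hFup'
    · exact hubPath_ju L (by omega) X Y hXmono hYmono D hD ri ra rj rb hri hra hrj hrb Wp cWp
        (fun ζ => by rw [hWp, hubB_ite_gate_true, hubB_ite_gate_false])
        (fun ζ => by rw [hcWp, hubB_ite_gate_true, hubB_ite_gate_false]) _ hFsub' hFup'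
  · -- (j,j)
    by_cases hL1 : L = 1
    · subst hL1
      exact hubPath_jj_one X Y D hD ri ra rj rb hri hra hrj hrb Wp cWp
        (fun ζ => by rw [hWp, hubB_ite_gate_true, hubB_ite_gate_true])
        (fun ζ => by rw [hcWp, hubB_ite_gate_true, hubB_ite_gate_true]) _ hFsub' hFup'
    · exact hubPath_jj L (by omega) X Y hXmono hYmono D hD ri ra rj rb hri hra hrj hrb Wp cWp
        (fun ζ => by rw [hWp, hubB_ite_gate_true, hubB_ite_gate_true])
        (fun ζ => by rw [hcWp, hubB_ite_gate_true, hubB_ite_gate_true]) _ hFsub' hFup'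

end Coefficientwise

end Summit.CriticalPhenomena.PercolationContinuityZ3.Theorems
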